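import Summits.ValiantsHypothesis.ValiantsHypothesis.Theorems.SymPencilPerFourCrossSixQuadratic
import Summits.ValiantsHypothesis.ValiantsHypothesis.Theorems.SymPencilPerFourColSixForms

/-!
# Route `SymPencil` — the space `W₂ = row 0 ⊕ span(E₁₀, E₁₁)` at size `27`, II: shift identities
# and the classification of the `a`-lever spaces (`--supports` stmt-ValiantsHypothesis-5674
# `SdcSuperquadratic`; cell `(10,6,6)`; rung currency only, nothing here bears on `VP ≠ VNP`)

Complement coordinates of `W₂`: `u = (r, c)` with `r (0,j) = x_{2,j+1}`, `r (1,j) = x_{3,j+1}`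
(`j < 3`) and `c = (x₁₂, x₁₃, x₂₀, x₃₀)`.
* `per_shift_w2_a`: for `a = E₀₁+E₀₂+E₀₃` and the shifts `w = pE₁₀ + qE₁₁ ∈ W₂`:
  `per(x+w+ta) - per(x+w) - per(x+ta) + per(x) = t (p F¹ + q F²)`,
  `F¹ = x₂'ᵀ A x₃'` (`A = 𝟙𝟙ᵀ - 1`), `F² = x₂₀(x₃₂+x₃₃) + x₃₀(x₂₂+x₂₃)`;
* `per_shift_w2_b`: for `b = E₁₀` and the shifts `α ∈ row 0`:
  `… = t (α₁ Q₂₃ + α₂ Q₁₃ + α₃ Q₁₂)`, `Q_{pq} = x₂ₚx₃q + x₂qx₃ₚ`;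
* `finrank_le_finrank_map_add_finrank_ker` (bookkeeping);
* `w2_classify_a`: a subspace `S` of the complement (in `u`-coordinates) of dimension `≥ 7` on
  which `F¹` and `F²` vanish is contained in `X⁺ = {x₃₂ = x₃₃ = 0, x₂₂ + x₂₃ = 0}` or in
  `X⁻ = {x₂₂ = x₂₃ = 0, x₃₂ + x₃₃ = 0}` (proof: `S ⊇ {r = 0}` by
  `CrossSixQuadratic.finrank_le_three_of_isotropic`, then polarisation and `x₂₂x₃₃ ≡ 0`).
`Cruxes/SdcSuperquadratic/PENCIL-CROSS-27.md` rev 6 §W₂.  No definitions, no named facts.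
[folklore]
-/

noncomputable section

-- single-conjunct layout: Sub = Summit, duplicated namespace component intended
set_option linter.dupNamespace false

namespace Summit.ValiantsHypothesis.ValiantsHypothesis.Theorems.SymPencilPerFourW2Forms

open Matrix MvPolynomial Module
open Literature.Computability.AlgebraicComplexity
open Summit.ValiantsHypothesis.ValiantsHypothesis.Theorems.SymPencilPerFourCrossSixQuadratic
open Literature.Computability.AlgebraicComplexity.AlperBogartVelasco

universe u

variable {k : Type u} [Field k]

/-- Shift identity for the `a`-lever of `W₂` (`a = E₀₁+E₀₂+E₀₃`, shifts `pE₁₀ + qE₁₁`).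
[folklore] -/
theorem per_shift_w2_a (x : Fin 4 × Fin 4 → k) (p q t : k) :
    MvPolynomial.eval (x + (fun z : Fin 4 × Fin 4 =>
        (Matrix.of ![![0, 0, 0, 0], ![p, q, 0, 0], ![0, 0, 0, 0], ![0, 0, 0, 0]]) z.1 z.2) +
        t • (fun z : Fin 4 × Fin 4 =>
          (Matrix.of ![![0, 1, 1, 1], ![0, 0, 0, 0], ![0, 0, 0, 0], ![0, 0, 0, 0]]) z.1 z.2))
        (perPoly (Fin 4) k) -
      MvPolynomial.eval (x + (fun z : Fin 4 × Fin 4 =>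
        (Matrix.of ![![0, 0, 0, 0], ![p, q, 0, 0], ![0, 0, 0, 0], ![0, 0, 0, 0]]) z.1 z.2))
        (perPoly (Fin 4) k) -
      (MvPolynomial.eval (x + t • (fun z : Fin 4 × Fin 4 =>
          (Matrix.of ![![0, 1, 1, 1], ![0, 0, 0, 0], ![0, 0, 0, 0], ![0, 0, 0, 0]]) z.1 z.2))
          (perPoly (Fin 4) k) - MvPolynomial.eval x (perPoly (Fin 4) k)) =
      t * (p * (x (2, 1) * (x (3, 2) + x (3, 3)) + x (2, 2) * (x (3, 1) + x (3, 3)) +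
          x (2, 3) * (x (3, 1) + x (3, 2))) +
        q * (x (2, 0) * (x (3, 2) + x (3, 3)) + x (3, 0) * (x (2, 2) + x (2, 3)))) := by
  simp only [eval_perPoly, Matrix.permanent_fin_four_row, Matrix.of_apply, Pi.add_apply,
    Pi.smul_apply, smul_eq_mul]
  simp
  ring

/-- Shift identity for the `b`-lever of `W₂` (`b = E₁₀`, shifts `α ∈ row 0`): the three
permanental `2 × 2` minors of rows `2,3` × columns `1,2,3`. [folklore] -/
theorem per_shift_w2_b (x : Fin 4 × Fin 4 → k) (α₀ α₁ α₂ α₃ t : k) :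
    MvPolynomial.eval (x + (fun z : Fin 4 × Fin 4 =>
        (Matrix.of ![![α₀, α₁, α₂, α₃], ![0, 0, 0, 0], ![0, 0, 0, 0], ![0, 0, 0, 0]]) z.1 z.2) +
        t • (fun z : Fin 4 × Fin 4 =>
          (Matrix.of ![![0, 0, 0, 0], ![1, 0, 0, 0], ![0, 0, 0, 0], ![0, 0, 0, 0]]) z.1 z.2))
        (perPoly (Fin 4) k) -
      MvPolynomial.eval (x + (fun z : Fin 4 × Fin 4 =>
        (Matrix.of ![![α₀, α₁, α₂, α₃], ![0, 0, 0, 0], ![0, 0, 0, 0], ![0, 0, 0, 0]]) z.1 z.2))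
        (perPoly (Fin 4) k) -
      (MvPolynomial.eval (x + t • (fun z : Fin 4 × Fin 4 =>
          (Matrix.of ![![0, 0, 0, 0], ![1, 0, 0, 0], ![0, 0, 0, 0], ![0, 0, 0, 0]]) z.1 z.2))
          (perPoly (Fin 4) k) - MvPolynomial.eval x (perPoly (Fin 4) k)) =
      t * (α₁ * (x (2, 2) * x (3, 3) + x (2, 3) * x (3, 2)) +
        α₂ * (x (2, 1) * x (3, 3) + x (2, 3) * x (3, 1)) +
        α₃ * (x (2, 1) * x (3, 2) + x (2, 2) * x (3, 1))) := by
  simp only [eval_perPoly, Matrix.permanent_fin_four_row, Matrix.of_apply, Pi.add_apply,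
    Pi.smul_apply, smul_eq_mul]
  simp
  ring

/-- Bookkeeping: `dim p ≤ dim f(p) + dim ker f`. [folklore] -/
theorem finrank_le_finrank_map_add_finrank_ker {M N : Type*} [AddCommGroup M] [Module k M]
    [AddCommGroup N] [Module k N] [FiniteDimensional k M] (f : M →ₗ[k] N) (p : Submodule k M) :
    finrank k p ≤ finrank k (p.map f) + finrank k (LinearMap.ker f) := by
  have h := LinearMap.finrank_range_add_finrank_ker (f.domRestrict p)
  rw [LinearMap.range_domRestrict, LinearMap.ker_domRestrict] at h
  have h2 : finrank k ((LinearMap.ker f).comap p.subtype) ≤ finrank k (LinearMap.ker f) := by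
    rw [(Submodule.equivMapOfInjective p.subtype p.injective_subtype _).finrank_eq]
    exact Submodule.finrank_mono (Submodule.map_comap_le _ _)
  omega

/-- **Classification of the `a`-lever spaces of `W₂`.**  In complement coordinates
`u = (r, c)` (`r (0,j) = x_{2,j+1}`, `r (1,j) = x_{3,j+1}`, `c = (x₁₂,x₁₃,x₂₀,x₃₀)`): a subspace
of dimension `≥ 7` on which `F¹ = rᵀ₀ A r₁` and `F² = c₂ (r₁₁ + r₁₂) + c₃ (r₀₁ + r₀₂)` vanish lies
in `X⁺ = {r₁₁ = r₁₂ = 0, r₀₁ + r₀₂ = 0}` or in `X⁻ = {r₀₁ = r₀₂ = 0, r₁₁ + r₁₂ = 0}`. [folklore] -/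
theorem w2_classify_a [CharZero k] (S : Submodule k ((Fin 2 × Fin 3 → k) × (Fin 4 → k)))
    (hq1 : ∀ u ∈ S, u.1 (0, 0) * (u.1 (1, 1) + u.1 (1, 2)) + u.1 (0, 1) * (u.1 (1, 0) + u.1 (1, 2)) +
      u.1 (0, 2) * (u.1 (1, 0) + u.1 (1, 1)) = 0)
    (hq2 : ∀ u ∈ S, u.2 2 * (u.1 (1, 1) + u.1 (1, 2)) + u.2 3 * (u.1 (0, 1) + u.1 (0, 2)) = 0)
    (h7 : 7 ≤ finrank k S) :
    (∀ u ∈ S, u.1 (1, 1) = 0 ∧ u.1 (1, 2) = 0 ∧ u.1 (0, 1) + u.1 (0, 2) = 0) ∨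
      (∀ u ∈ S, u.1 (0, 1) = 0 ∧ u.1 (0, 2) = 0 ∧ u.1 (1, 1) + u.1 (1, 2) = 0) := by
  classical
  -- the form `q_A`
  set A₃ : Matrix (Fin 3) (Fin 3) k := Matrix.of ![![0, 1, 1], ![1, 0, 1], ![1, 1, 0]] with hA₃
  let q : (Fin 2 × Fin 3 → k) → k := fun r => ∑ i, ∑ j, r (0, i) * A₃ i j * r (1, j)
  have hq : ∀ r, q r = ∑ i, ∑ j, r (0, i) * A₃ i j * r (1, j) := fun r => rfl
  have hq' : ∀ r : Fin 2 × Fin 3 → k, q r = r (0, 0) * (r (1, 1) + r (1, 2)) +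
      r (0, 1) * (r (1, 0) + r (1, 2)) + r (0, 2) * (r (1, 0) + r (1, 1)) := fun r => by
    simp only [hq, hA₃, Fin.sum_univ_three]
    simp; ring
  let β : (Fin 2 × Fin 3 → k) → (Fin 2 × Fin 3 → k) → k := fun r s =>
    ∑ i, ∑ j, (r (0, i) * A₃ i j * s (1, j) + s (0, i) * A₃ i j * r (1, j))
  have hβ : ∀ r s, β r s = ∑ i, ∑ j, (r (0, i) * A₃ i j * s (1, j) + s (0, i) * A₃ i j * r (1, j)) :=
    fun r s => rfl
  have hA₃s : A₃ᵀ = A₃ := by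
    rw [hA₃]; ext i j; fin_cases i <;> fin_cases j <;> simp [Matrix.transpose_apply]
  have hA₃u : IsUnit A₃.det := by
    rw [hA₃, Matrix.det_fin_three]; simp
  -- Step A: `{r = 0} ≤ S`
  set F := LinearMap.fst k (Fin 2 × Fin 3 → k) (Fin 4 → k) with hF
  have hmap3 : finrank k ((S ⊔ LinearMap.ker F).map F) ≤ 3 := by
    refine finrank_le_three_of_isotropic A₃ q β hA₃s hA₃u hq hβ _ ?_
    rintro _ ⟨u, hu, rfl⟩
    obtain ⟨s, hs, w, hw, rfl⟩ := Submodule.mem_sup.1 hu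
    rw [LinearMap.mem_ker, hF, LinearMap.fst_apply] at hw
    rw [hF, LinearMap.fst_apply, Prod.fst_add, hw, add_zero, hq']
    exact hq1 s hs
  have hker4 : finrank k (LinearMap.ker F) = 4 := by
    rw [hF, LinearMap.ker_fst, LinearMap.finrank_range_of_inj LinearMap.inr_injective]
    simp
  have hle7 : finrank k (S ⊔ LinearMap.ker F : Submodule k _) ≤ 7 :=
    (finrank_le_finrank_map_add_finrank_ker F _).trans (by omega)
  have hKS : LinearMap.ker F ≤ S := by
    have h := Submodule.eq_of_le_of_finrank_le (le_sup_left : S ≤ S ⊔ LinearMap.ker F) (by omega)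
    rw [h]; exact le_sup_right
  have h20 : ((0 : Fin 2 × Fin 3 → k), (Pi.single 2 1 : Fin 4 → k)) ∈ S :=
    hKS (by rw [LinearMap.mem_ker, hF, LinearMap.fst_apply])
  have h30 : ((0 : Fin 2 × Fin 3 → k), (Pi.single 3 1 : Fin 4 → k)) ∈ S :=
    hKS (by rw [LinearMap.mem_ker, hF, LinearMap.fst_apply])
  -- Step B: the linear relations
  have hl1 : ∀ u ∈ S, u.1 (1, 1) + u.1 (1, 2) = 0 := by
    intro u hu
    have h := hq2 _ (S.add_mem hu h20)
    have h0 := hq2 u hu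
    simp only [Prod.fst_add, Prod.snd_add, Pi.add_apply, Pi.zero_apply, add_zero,
      Pi.single_apply] at h
    simp at h
    linear_combination h - h0
  have hl2 : ∀ u ∈ S, u.1 (0, 1) + u.1 (0, 2) = 0 := by
    intro u hu
    have h := hq2 _ (S.add_mem hu h30)
    have h0 := hq2 u hu
    simp only [Prod.fst_add, Prod.snd_add, Pi.add_apply, Pi.zero_apply, add_zero,
      Pi.single_apply] at h
    simp at h
    linear_combination h - h0
  -- Step C: `r₀₁ r₁₁ ≡ 0`
  have hprod : ∀ u ∈ S, u.1 (0, 1) * u.1 (1, 1) = 0 := by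
    intro u hu
    have h := hq1 u hu
    have l1 := hl1 u hu
    have l2 := hl2 u hu
    have e12 : u.1 (1, 2) = -u.1 (1, 1) := by linear_combination l1
    have e02 : u.1 (0, 2) = -u.1 (0, 1) := by linear_combination l2
    rw [e12, e02] at h
    have h' : (-2 : k) * (u.1 (0, 1) * u.1 (1, 1)) = 0 := by linear_combination h
    exact (mul_eq_zero.1 h').resolve_left (by norm_num)
  -- Step D: dichotomy
  by_cases hA : ∀ u ∈ S, u.1 (1, 1) = 0
  · left
    intro u hu
    exact ⟨hA u hu, by linear_combination hl1 u hu - hA u hu, hl2 u hu⟩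
  · right
    push Not at hA
    obtain ⟨w, hw, hw11⟩ := hA
    have hw01 : w.1 (0, 1) = 0 := (mul_eq_zero.1 (hprod w hw)).resolve_right hw11
    intro u hu
    have hu01 : u.1 (0, 1) = 0 := by
      by_contra h01
      have hu11 : u.1 (1, 1) = 0 := (mul_eq_zero.1 (hprod u hu)).resolve_left h01
      have h := hprod _ (S.add_mem hu hw)
      simp only [Prod.fst_add, Pi.add_apply, hu11, hw01, add_zero, zero_add] at h
      exact ((mul_eq_zero.1 h).elim h01 hw11)
    exact ⟨hu01, by linear_combination hl2 u hu - hu01, hl1 u hu⟩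

end Summit.ValiantsHypothesis.ValiantsHypothesis.Theorems.SymPencilPerFourW2Forms

end
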